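import Literature.Probability.RandomPlanarGeometry.ObliqueRBMWedgeDensity
import HarnessLib

/-!
# The one-step (Markov) structure of the canonical obliquely reflected Brownian motion

Layer of the proof of
`Literature.Probability.RandomPlanarGeometry.LawlerSchrammWerner2001_orbm_uniformHitting`
(`ObliqueRBMWedge.lean`): the Markov mechanism behind the Dynkin identity for the canonical
reflected process `canORBM` (`ObliqueRBMWedgeCanonical.lean`).

* `rawPairBM w u = w.1 u + i w.2 u` — the complex path of a raw pair path, so that
  `pairBM t ω = rawPairBM (pairPath ω) t` and `rawPairBM (pairShift s ω) u = β_{s+u}(ω) − β_s(ω)`;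
* `orbmStep z h w` — **the one-step map**: the position after time `h` of the path started at
  `z`, driven by the raw pair path `w` and reflected (Skorokhod map in quadrant coordinates,
  dyadic version so that it is jointly measurable, `measurable_orbmStep`);
* `canORBM_add` — **flow identity**: `Z_{s+h}(ω) = orbmStep (Z_s ω) h (pairShift s ω)` (the
  cocycle property `skorokhodBdry_add` of the reflection map in each coordinate);
* `orbmStep_pairPath` — from a fresh pair path, `orbmStep z h (pairPath ω') = z + β_h(ω') +
  ζ ℓ¹ + ℓ²` with the explicit boundary terms `stepL₁ z h ω'`, `stepL₂ z h ω'`, and their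
  elementary bounds (`stepL₁_nonneg`, `stepL₁_le_stepSup`, `stepL₁_eq_zero_of_le`,
  `quad_mul_stepL₁_le`, …) in terms of `stepSup h ω' = runSup_h(ω'₁) + runSup_h(ω'₂)`;
* `integral_comp_pairShift_eq` — **Markov factorisation of expectations** (Bochner form of
  `Process.lintegral_comp_pairShift_eq`): for bounded jointly measurable `G` and `ξ` measurable
  with respect to the past of the pair at time `s`,
  `E[G(ξ, pairShift s)] = E[ω ↦ ∫ G(ξ ω, pairPath ω') dP(ω')]`;
* `integral_indicator_mul_sub_eq` — the resulting one-step identity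
  `E[𝟙_A (F(Z_{s+h}) − F(Z_s))] = E[𝟙_A G_h(Z_s)]` for `A` in the past at time `s`, with
  `oneStep F h z = ∫ F(orbmStep z h (pairPath ω')) dP(ω') − F z`;
* `measurableSet_comap_coe_lt_canHit` — the event `{s < canHit M}` ("level `< M` on `[0, s]`")
  belongs to the past at time `s`.

## References

* W. Werner, LNM 1840 (2004), Ch. 5 §5.1; J.-F. Le Gall, *Brownian Motion, Martingales, and
  Stochastic Calculus* (2016), Ch. 6 (Markov property and generators). [WernerStFlour2004]
-/

noncomputable section

open MeasureTheory ProbabilityTheory Complex Set Filter Finset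
open scoped NNReal Real Topology ENNReal BigOperators

namespace Literature.Probability.RandomPlanarGeometry

open Literature.Probability.Process

/-! ### Raw pair paths and the one-step map -/

/-- The complex path `u ↦ w.1 u + i w.2 u` of a raw pair path `w`. [folklore] -/
def rawPairBM (w : WienerPair) (u : ℝ≥0) : ℂ := (w.1 u : ℂ) + (w.2 u : ℂ) * I

/-- Auxiliary statement (`rawPairBM_re`). [folklore] -/
@[simp] theorem rawPairBM_re (w : WienerPair) (u : ℝ≥0) : (rawPairBM w u).re = w.1 u := by
  simp [rawPairBM]

/-- Auxiliary statement (`rawPairBM_im`). [folklore] -/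
@[simp] theorem rawPairBM_im (w : WienerPair) (u : ℝ≥0) : (rawPairBM w u).im = w.2 u := by
  simp [rawPairBM]

/-- `β_t(ω) = rawPairBM (pairPath ω) t`. [folklore] -/
theorem rawPairBM_pairPath (ω : WienerPair) (t : ℝ≥0) : rawPairBM (pairPath ω) t = pairBM t ω := by
  apply Complex.ext <;> simp [pairPath]

/-- `rawPairBM (pairShift s ω) u = β_{s+u}(ω) − β_s(ω)`. [folklore] -/
theorem rawPairBM_pairShift (s : ℝ≥0) (ω : WienerPair) (u : ℝ≥0) :
    rawPairBM (pairShift s ω) u = pairBM (s + u) ω - pairBM s ω := by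
  apply Complex.ext <;> simp [pairShift]

/-- Measurability of `w ↦ rawPairBM w u`. [folklore] -/
theorem measurable_rawPairBM (u : ℝ≥0) : Measurable fun w : WienerPair ↦ rawPairBM w u := by
  unfold rawPairBM
  have h1 : Measurable fun w : WienerPair ↦ w.1 u := (measurable_pi_apply u).comp measurable_fst
  have h2 : Measurable fun w : WienerPair ↦ w.2 u := (measurable_pi_apply u).comp measurable_snd
  fun_prop

/-- `quadX` is additive under subtraction. [folklore] -/
theorem quadX_sub (a b : ℂ) : quadX (a - b) = quadX a - quadX b := by
  simp only [quadX, sub_re, sub_im]; ring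

/-- `quadY` is additive under subtraction. [folklore] -/
theorem quadY_sub (a b : ℂ) : quadY (a - b) = quadY a - quadY b := by
  simp only [quadY, sub_im]; ring

/-- **The one-step map**: position after time `h` of the reflected path started at `z` and
driven by the raw pair path `w` — `z + w(h) + ζ ℓ¹ + ℓ²` with the boundary terms of the two
quadrant coordinates of `z + w` (dyadic suprema, so that the map is jointly measurable).
[cite: WernerStFlour2004, Ch. 5 §5.1] -/
def orbmStep (z : ℂ) (h : ℝ≥0) (w : WienerPair) : ℂ :=
  z + rawPairBM w h
    + dirSixty * ((skorokhodBdryDyad (fun u ↦ quadY z + quadY (rawPairBM w u)) h : ℝ) : ℂ)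
    + ((skorokhodBdryDyad (fun u ↦ quadX z + quadX (rawPairBM w u)) h : ℝ) : ℂ)

/-- Joint measurability of a dyadic boundary term in `(z, w)`. [folklore] -/
theorem measurable_skorokhodBdryDyad_quad {q : ℂ → ℝ} (hq : Measurable q) (h : ℝ≥0) :
    Measurable fun p : ℂ × WienerPair ↦
      skorokhodBdryDyad (fun u ↦ q p.1 + q (rawPairBM p.2 u)) h := by
  refine Measurable.iSup fun n ↦ measurable_const.max (Measurable.neg ?_)
  exact (hq.comp measurable_fst).add (hq.comp ((measurable_rawPairBM _).comp measurable_snd))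

/-- **The one-step map is jointly measurable in `(z, w)`.** [folklore] -/
theorem measurable_orbmStep (h : ℝ≥0) : Measurable fun p : ℂ × WienerPair ↦ orbmStep p.1 h p.2 := by
  unfold orbmStep
  have h0 : Measurable fun p : ℂ × WienerPair ↦ rawPairBM p.2 h :=
    (measurable_rawPairBM h).comp measurable_snd
  have h1 := measurable_skorokhodBdryDyad_quad measurable_quadY h
  have h2 := measurable_skorokhodBdryDyad_quad measurable_quadX h
  exact ((measurable_fst.add h0).add (measurable_const.mul (Complex.measurable_ofReal.comp h1))).add
    (Complex.measurable_ofReal.comp h2)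

/-- Measurability of `w ↦ orbmStep z h w`. [folklore] -/
theorem measurable_orbmStep_right (z : ℂ) (h : ℝ≥0) : Measurable fun w : WienerPair ↦ orbmStep z h w :=
  (measurable_orbmStep h).comp (measurable_const.prodMk measurable_id)

/-! ### The flow identity -/

/-- **Flow identity**: `Z_{s+h}(ω) = orbmStep (Z_s ω) h (pairShift s ω)` — after time `s` the
reflected process is the reflection, restarted from its current position, of the increments of
the driving Brownian motion. [cite: WernerStFlour2004, Ch. 5 §5.1] -/
theorem canORBM_add (s h : ℝ≥0) (ω : WienerPair) :
    canORBM (s + h) ω = orbmStep (canORBM s ω) h (pairShift s ω) := by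
  have hcx := continuous_quadX_pairBM ω
  have hcy := continuous_quadY_pairBM ω
  -- the increment paths restarted from the current coordinates are continuous
  have hpx : (fun u ↦ quadX (canORBM s ω) + quadX (rawPairBM (pairShift s ω) u)) =
      fun u ↦ (quadX (pairBM s ω) + skorokhodBdry (fun r ↦ quadX (pairBM r ω)) s) +
        (quadX (pairBM (s + u) ω) - quadX (pairBM s ω)) := by
    funext u
    rw [rawPairBM_pairShift, quadX_sub, quadX_canORBM]
    rfl
  have hpy : (fun u ↦ quadY (canORBM s ω) + quadY (rawPairBM (pairShift s ω) u)) =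
      fun u ↦ (quadY (pairBM s ω) + skorokhodBdry (fun r ↦ quadY (pairBM r ω)) s) +
        (quadY (pairBM (s + u) ω) - quadY (pairBM s ω)) := by
    funext u
    rw [rawPairBM_pairShift, quadY_sub, quadY_canORBM]
    rfl
  have hcx' : Continuous fun u ↦ (quadX (pairBM s ω) + skorokhodBdry (fun r ↦ quadX (pairBM r ω)) s) +
      (quadX (pairBM (s + u) ω) - quadX (pairBM s ω)) := by
    have : Continuous fun u : ℝ≥0 ↦ quadX (pairBM (s + u) ω) :=
      hcx.comp (continuous_const.add continuous_id)
    fun_prop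
  have hcy' : Continuous fun u ↦ (quadY (pairBM s ω) + skorokhodBdry (fun r ↦ quadY (pairBM r ω)) s) +
      (quadY (pairBM (s + u) ω) - quadY (pairBM s ω)) := by
    have : Continuous fun u : ℝ≥0 ↦ quadY (pairBM (s + u) ω) :=
      hcy.comp (continuous_const.add continuous_id)
    fun_prop
  have hLx : canL₂ (s + h) ω = canL₂ s ω +
      skorokhodBdryDyad (fun u ↦ quadX (canORBM s ω) + quadX (rawPairBM (pairShift s ω) u)) h := by
    rw [hpx, skorokhodBdryDyad_eq hcx' h]
    exact skorokhodBdry_add hcx s h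
  have hLy : canL₁ (s + h) ω = canL₁ s ω +
      skorokhodBdryDyad (fun u ↦ quadY (canORBM s ω) + quadY (rawPairBM (pairShift s ω) u)) h := by
    rw [hpy, skorokhodBdryDyad_eq hcy' h]
    exact skorokhodBdry_add hcy s h
  show pairBM (s + h) ω + dirSixty * ((canL₁ (s + h) ω : ℝ) : ℂ) + ((canL₂ (s + h) ω : ℝ) : ℂ) = _
  rw [hLy, hLx, orbmStep, rawPairBM_pairShift,
    show canORBM s ω = pairBM s ω + dirSixty * ((canL₁ s ω : ℝ) : ℂ) + ((canL₂ s ω : ℝ) : ℂ) from rfl]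
  push_cast
  ring

/-! ### The one-step map from a fresh pair path -/

/-- The boundary term on the first side of the step from `z` driven by `pairPath ω'`:
`ℓ¹ = sup_{u ≤ h} max 0 (−(y(z) + y(β_u(ω'))))`. [folklore] -/
def stepL₁ (z : ℂ) (h : ℝ≥0) (ω' : WienerPair) : ℝ :=
  skorokhodBdry (fun u ↦ quadY z + quadY (pairBM u ω')) h

/-- The boundary term on the second side of the step from `z` driven by `pairPath ω'`. [folklore] -/
def stepL₂ (z : ℂ) (h : ℝ≥0) (ω' : WienerPair) : ℝ :=
  skorokhodBdry (fun u ↦ quadX z + quadX (pairBM u ω')) h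

/-- **The step from a fresh pair path**: `orbmStep z h (pairPath ω') = z + β_h(ω') + ζ ℓ¹ + ℓ²`.
[folklore] -/
theorem orbmStep_pairPath (z : ℂ) (h : ℝ≥0) (ω' : WienerPair) :
    orbmStep z h (pairPath ω') =
      z + pairBM h ω' + dirSixty * ((stepL₁ z h ω' : ℝ) : ℂ) + ((stepL₂ z h ω' : ℝ) : ℂ) := by
  have hcx : Continuous fun u ↦ quadX z + quadX (pairBM u ω') :=
    continuous_const.add (continuous_quadX_pairBM ω')
  have hcy : Continuous fun u ↦ quadY z + quadY (pairBM u ω') :=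
    continuous_const.add (continuous_quadY_pairBM ω')
  simp only [orbmStep, rawPairBM_pairPath, stepL₁, stepL₂]
  rw [skorokhodBdryDyad_eq hcy, skorokhodBdryDyad_eq hcx]

/-- Quadrant coordinates of the step: `x(z') = x(z) + x(β_h) + ℓ²`. [folklore] -/
theorem quadX_orbmStep_pairPath (z : ℂ) (h : ℝ≥0) (ω' : WienerPair) :
    quadX (orbmStep z h (pairPath ω')) = quadX z + quadX (pairBM h ω') + stepL₂ z h ω' := by
  rw [orbmStep_pairPath, quadX_add, quadX_add, quadX_add, quadX_ofReal, mul_comm,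
    quadX_ofReal_mul_dirSixty, add_zero]

/-- Quadrant coordinates of the step: `y(z') = y(z) + y(β_h) + ℓ¹`. [folklore] -/
theorem quadY_orbmStep_pairPath (z : ℂ) (h : ℝ≥0) (ω' : WienerPair) :
    quadY (orbmStep z h (pairPath ω')) = quadY z + quadY (pairBM h ω') + stepL₁ z h ω' := by
  rw [orbmStep_pairPath, quadY_add, quadY_add, quadY_add, quadY_ofReal, mul_comm,
    quadY_ofReal_mul_dirSixty, add_zero]

/-- The sum of the two running suprema of `|B¹|`, `|B²|` on `[0, h]`: the size of the step.
[folklore] -/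
def stepSup (h : ℝ≥0) (ω' : WienerPair) : ℝ := runSup h ω'.1 + runSup h ω'.2

/-- Auxiliary statement (`stepSup_nonneg`). [folklore] -/
theorem stepSup_nonneg (h : ℝ≥0) (ω' : WienerPair) : 0 ≤ stepSup h ω' :=
  add_nonneg (runSup_nonneg h _) (runSup_nonneg h _)

/-- Auxiliary statement (`measurable_stepSup`). [folklore] -/
theorem measurable_stepSup (h : ℝ≥0) : Measurable (stepSup h) :=
  ((measurable_runSup h).comp measurable_fst).add ((measurable_runSup h).comp measurable_snd)

/-- `|x(β_u)| ≤ stepSup` and `|y(β_u)| ≤ 2 stepSup`… precisely `|x(β_u)|, |y(β_u)| ≤ 2 stepSup h`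
for `u ≤ h`. [folklore] -/
theorem abs_quad_pairBM_le {h u : ℝ≥0} (hu : u ≤ h) (ω' : WienerPair) :
    |quadX (pairBM u ω')| ≤ 2 * stepSup h ω' ∧ |quadY (pairBM u ω')| ≤ 2 * stepSup h ω' := by
  have h1 := abs_brownian_le_runSup hu ω'.1
  have h2 := abs_brownian_le_runSup hu ω'.2
  have h3 : (1 : ℝ) < Real.sqrt 3 := by
    rw [show (1:ℝ) = Real.sqrt 1 by simp]
    exact Real.sqrt_lt_sqrt (by norm_num) (by norm_num)
  have h3pos : (0 : ℝ) < Real.sqrt 3 := by positivity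
  have hS := stepSup_nonneg h ω'
  have hr1 := runSup_nonneg h ω'.1
  have hr2 := runSup_nonneg h ω'.2
  constructor
  · rw [quadX, pairBM_re, pairBM_im]
    have : |brownian u ω'.2 / Real.sqrt 3| ≤ |brownian u ω'.2| := by
      rw [abs_div, abs_of_pos h3pos]
      exact div_le_self (abs_nonneg _) h3.le
    calc |brownian u ω'.1 - brownian u ω'.2 / Real.sqrt 3|
        ≤ |brownian u ω'.1| + |brownian u ω'.2 / Real.sqrt 3| := abs_sub _ _
      _ ≤ runSup h ω'.1 + runSup h ω'.2 := add_le_add h1 (this.trans h2)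
      _ ≤ 2 * stepSup h ω' := by unfold stepSup; linarith
  · rw [quadY, pairBM_im]
    have : |2 * brownian u ω'.2 / Real.sqrt 3| ≤ 2 * |brownian u ω'.2| := by
      rw [abs_div, abs_mul, abs_of_pos h3pos, abs_two]
      rw [div_le_iff₀ h3pos]
      nlinarith [abs_nonneg (brownian u ω'.2)]
    calc |2 * brownian u ω'.2 / Real.sqrt 3| ≤ 2 * |brownian u ω'.2| := this
      _ ≤ 2 * runSup h ω'.2 := by linarith
      _ ≤ 2 * stepSup h ω' := by unfold stepSup; linarith

/-- `‖β_h‖ ≤ stepSup h`. [folklore] -/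
theorem norm_pairBM_le_stepSup (h : ℝ≥0) (ω' : WienerPair) : ‖pairBM h ω'‖ ≤ stepSup h ω' := by
  have h1 := abs_brownian_le_runSup (le_refl h) ω'.1
  have h2 := abs_brownian_le_runSup (le_refl h) ω'.2
  calc ‖pairBM h ω'‖ ≤ |(pairBM h ω').re| + |(pairBM h ω').im| := Complex.norm_le_abs_re_add_abs_im _
    _ ≤ stepSup h ω' := by rw [pairBM_re, pairBM_im]; unfold stepSup; linarith

section StepBounds

variable {z : ℂ} {h : ℝ≥0} {ω' : WienerPair}

/-- Auxiliary statement (`stepL₁_nonneg`). [folklore] -/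
theorem stepL₁_nonneg (z : ℂ) (h : ℝ≥0) (ω' : WienerPair) : 0 ≤ stepL₁ z h ω' :=
  skorokhodBdry_nonneg (continuous_const.add (continuous_quadY_pairBM ω')) h

/-- Auxiliary statement (`stepL₂_nonneg`). [folklore] -/
theorem stepL₂_nonneg (z : ℂ) (h : ℝ≥0) (ω' : WienerPair) : 0 ≤ stepL₂ z h ω' :=
  skorokhodBdry_nonneg (continuous_const.add (continuous_quadX_pairBM ω')) h

/-- `ℓ¹ ≤ 2 stepSup` when `y(z) ≥ 0`. [folklore] -/
theorem stepL₁_le (hz : 0 ≤ quadY z) : stepL₁ z h ω' ≤ 2 * stepSup h ω' := by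
  have hc : Continuous fun u ↦ quadY z + quadY (pairBM u ω') :=
    continuous_const.add (continuous_quadY_pairBM ω')
  unfold stepL₁
  rw [skorokhodBdry_le_iff hc]
  intro u hu
  have := (abs_quad_pairBM_le hu ω').2
  refine max_le (by linarith [stepSup_nonneg h ω']) ?_
  linarith [neg_abs_le (quadY (pairBM u ω'))]

/-- `ℓ² ≤ 2 stepSup` when `x(z) ≥ 0`. [folklore] -/
theorem stepL₂_le (hz : 0 ≤ quadX z) : stepL₂ z h ω' ≤ 2 * stepSup h ω' := by
  have hc : Continuous fun u ↦ quadX z + quadX (pairBM u ω') :=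
    continuous_const.add (continuous_quadX_pairBM ω')
  unfold stepL₂
  rw [skorokhodBdry_le_iff hc]
  intro u hu
  have := (abs_quad_pairBM_le hu ω').1
  refine max_le (by linarith [stepSup_nonneg h ω']) ?_
  linarith [neg_abs_le (quadX (pairBM u ω'))]

/-- No push from the first side when `y(z) ≥ 2 stepSup`: `ℓ¹ = 0`. [folklore] -/
theorem stepL₁_eq_zero (hz : 2 * stepSup h ω' ≤ quadY z) : stepL₁ z h ω' = 0 := by
  refine le_antisymm ?_ (stepL₁_nonneg z h ω')
  have hc : Continuous fun u ↦ quadY z + quadY (pairBM u ω') :=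
    continuous_const.add (continuous_quadY_pairBM ω')
  unfold stepL₁
  rw [skorokhodBdry_le_iff hc]
  intro u hu
  have := (abs_quad_pairBM_le hu ω').2
  refine max_le le_rfl ?_
  linarith [neg_abs_le (quadY (pairBM u ω'))]

/-- No push from the second side when `x(z) ≥ 2 stepSup`: `ℓ² = 0`. [folklore] -/
theorem stepL₂_eq_zero (hz : 2 * stepSup h ω' ≤ quadX z) : stepL₂ z h ω' = 0 := by
  refine le_antisymm ?_ (stepL₂_nonneg z h ω')
  have hc : Continuous fun u ↦ quadX z + quadX (pairBM u ω') :=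
    continuous_const.add (continuous_quadX_pairBM ω')
  unfold stepL₂
  rw [skorokhodBdry_le_iff hc]
  intro u hu
  have := (abs_quad_pairBM_le hu ω').1
  refine max_le le_rfl ?_
  linarith [neg_abs_le (quadX (pairBM u ω'))]

/-- `ℓ¹ ≤ 2 stepSup · 𝟙{y(z) < 2 stepSup}` (`y(z) ≥ 0`). [folklore] -/
theorem stepL₁_le_indicator (hz : 0 ≤ quadY z) :
    stepL₁ z h ω' ≤ 2 * stepSup h ω' * {ω' | quadY z < 2 * stepSup h ω'}.indicator 1 ω' := by
  by_cases hc : quadY z < 2 * stepSup h ω'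
  · rw [indicator_of_mem (by exact hc), Pi.one_apply, mul_one]; exact stepL₁_le hz
  · rw [indicator_of_notMem (by exact hc), mul_zero, stepL₁_eq_zero (not_lt.1 hc)]

/-- `ℓ² ≤ 2 stepSup · 𝟙{x(z) < 2 stepSup}` (`x(z) ≥ 0`). [folklore] -/
theorem stepL₂_le_indicator (hz : 0 ≤ quadX z) :
    stepL₂ z h ω' ≤ 2 * stepSup h ω' * {ω' | quadX z < 2 * stepSup h ω'}.indicator 1 ω' := by
  by_cases hc : quadX z < 2 * stepSup h ω'
  · rw [indicator_of_mem (by exact hc), Pi.one_apply, mul_one]; exact stepL₂_le hz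
  · rw [indicator_of_notMem (by exact hc), mul_zero, stepL₂_eq_zero (not_lt.1 hc)]

/-- The first-order boundary product: `y(z) ℓ¹ ≤ 4 stepSup² 𝟙{y(z) < 2 stepSup}` (`y(z) ≥ 0`).
[folklore] -/
theorem quadY_mul_stepL₁_le (hz : 0 ≤ quadY z) :
    quadY z * stepL₁ z h ω' ≤ 4 * stepSup h ω' ^ 2 * {ω' | quadY z < 2 * stepSup h ω'}.indicator 1 ω' := by
  by_cases hc : quadY z < 2 * stepSup h ω'
  · rw [indicator_of_mem (by exact hc), Pi.one_apply, mul_one]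
    have h1 := stepL₁_le (h := h) (ω' := ω') hz
    have h2 := stepL₁_nonneg z h ω'
    nlinarith
  · rw [indicator_of_notMem (by exact hc), mul_zero, stepL₁_eq_zero (not_lt.1 hc), mul_zero]

/-- The first-order boundary product on the second side. [folklore] -/
theorem quadX_mul_stepL₂_le (hz : 0 ≤ quadX z) :
    quadX z * stepL₂ z h ω' ≤ 4 * stepSup h ω' ^ 2 * {ω' | quadX z < 2 * stepSup h ω'}.indicator 1 ω' := by
  by_cases hc : quadX z < 2 * stepSup h ω'
  · rw [indicator_of_mem (by exact hc), Pi.one_apply, mul_one]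
    have h1 := stepL₂_le (h := h) (ω' := ω') hz
    have h2 := stepL₂_nonneg z h ω'
    nlinarith
  · rw [indicator_of_notMem (by exact hc), mul_zero, stepL₂_eq_zero (not_lt.1 hc), mul_zero]

end StepBounds

/-! ### Markov factorisation of expectations (Bochner form) -/

/-- **Markov factorisation of expectations.** For a bounded jointly measurable real `G`, a random
variable `ξ` measurable with respect to the past of the pair at time `s`, and the shifted pair
`pairShift s`: `E[G(ξ, pairShift s)] = E[ω ↦ ∫ G(ξ ω, pairPath ω') dP(ω')]` (independence of the
shifted pair from the past, and `law(pairShift s) = law(pairPath)`). [folklore] -/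
theorem integral_comp_pairShift_eq {X : Type*} [MeasurableSpace X] (s : ℝ≥0) {ξ : WienerPair → X}
    (hξ : Measurable[MeasurableSpace.comap (pairPast s) inferInstance] ξ)
    {G : X × WienerPair → ℝ} (hG : Measurable G) {C : ℝ} (hC : ∀ p, |G p| ≤ C) :
    ∫ ω, G (ξ ω, pairShift s ω) ∂wienerPair =
      ∫ ω, ∫ ω', G (ξ ω, pairPath ω') ∂wienerPair ∂wienerPair := by
  have hξm : Measurable ξ := hξ.mono (measurable_pairPast s).comap_le le_rfl
  have hind : IndepFun ξ (pairShift s) wienerPair := by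
    have h := indepFun_pairShift_pairPast s
    rw [IndepFun_iff_Indep] at h ⊢
    exact (indep_of_indep_of_le_right h (measurable_iff_comap_le.1 hξ)).symm
  have hlaw : wienerPair.map (fun ω => (ξ ω, pairShift s ω)) =
      (wienerPair.map ξ).prod (wienerPair.map (pairShift s)) :=
    (indepFun_iff_map_prod_eq_prod_map_map hξm.aemeasurable
      (measurable_pairShift s).aemeasurable).1 hind
  haveI : IsProbabilityMeasure (wienerPair.map ξ) := Measure.isProbabilityMeasure_map hξm.aemeasurable
  haveI : IsProbabilityMeasure (wienerPair.map (pairShift s)) :=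
    Measure.isProbabilityMeasure_map (measurable_pairShift s).aemeasurable
  have hGint : ∀ (μ : Measure (X × WienerPair)) [IsFiniteMeasure μ], Integrable G μ := fun μ _ ↦
    Integrable.of_bound hG.aestronglyMeasurable C (ae_of_all _ fun p ↦ by
      rw [Real.norm_eq_abs]; exact hC p)
  calc ∫ ω, G (ξ ω, pairShift s ω) ∂wienerPair
      = ∫ p, G p ∂(wienerPair.map fun ω => (ξ ω, pairShift s ω)) := by
        rw [integral_map (hξm.prodMk (measurable_pairShift s)).aemeasurable hG.aestronglyMeasurable]
    _ = ∫ p, G p ∂((wienerPair.map ξ).prod (wienerPair.map (pairShift s))) := by rw [hlaw]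
    _ = ∫ x, ∫ w, G (x, w) ∂(wienerPair.map (pairShift s)) ∂(wienerPair.map ξ) :=
        integral_prod _ (hGint _)
    _ = ∫ x, ∫ w, G (x, w) ∂(wienerPair.map pairPath) ∂(wienerPair.map ξ) := by
        rw [map_pairShift_eq_map_pairPath]
    _ = ∫ x, ∫ ω', G (x, pairPath ω') ∂wienerPair ∂(wienerPair.map ξ) := by
        congr 1
        funext x
        have hGx : Measurable fun w => G (x, w) := hG.comp (measurable_const.prodMk measurable_id)
        rw [integral_map measurable_pairPath.aemeasurable hGx.aestronglyMeasurable]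
    _ = ∫ ω, ∫ ω', G (ξ ω, pairPath ω') ∂wienerPair ∂wienerPair := by
        have hF : Measurable fun x => ∫ ω', G (x, pairPath ω') ∂wienerPair := by
          refine Measurable.stronglyMeasurable ?_ |>.measurable
          exact (hG.comp (measurable_fst.prodMk (measurable_pairPath.comp measurable_snd))).stronglyMeasurable.integral_prod_right'
            |>.measurable
        rw [integral_map hξm.aemeasurable hF.aestronglyMeasurable]

/-! ### The one-step expectation and the one-step identity -/

/-- **The one-step expectation** `G_h(z) = ∫ F(orbmStep z h (pairPath ω')) dP(ω') − F(z)`: the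
expected change of `F` along one step of length `h` of the reflected process started at `z`.
[folklore] -/
def oneStep (F : ℂ → ℝ) (h : ℝ≥0) (z : ℂ) : ℝ :=
  (∫ ω', F (orbmStep z h (pairPath ω')) ∂wienerPair) - F z

/-- The kernel `((b, z), w) ↦ clamp(b) · (F(orbmStep z h w) − F z)` of the one-step identity
(`clamp` to `[−1, 1]` keeps it bounded for every real `b`; it is the identity on indicator values).
[folklore] -/
def stepKernel (F : ℂ → ℝ) (h : ℝ≥0) (p : (ℝ × ℂ) × WienerPair) : ℝ :=
  max (-1) (min 1 p.1.1) * (F (orbmStep p.1.2 h p.2) - F p.1.2)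

/-- Measurability of the kernel. [folklore] -/
theorem measurable_stepKernel {F : ℂ → ℝ} (hFm : Measurable F) (h : ℝ≥0) :
    Measurable (stepKernel F h) := by
  unfold stepKernel
  refine (measurable_const.max (measurable_const.min (measurable_fst.comp measurable_fst))).mul ?_
  exact (hFm.comp ((measurable_orbmStep h).comp ((measurable_snd.comp measurable_fst).prodMk
    measurable_snd))).sub (hFm.comp (measurable_snd.comp measurable_fst))

/-- Boundedness of the kernel: `|stepKernel| ≤ 2C` if `|F| ≤ C`. [folklore] -/
theorem abs_stepKernel_le {F : ℂ → ℝ} {C : ℝ} (hC : ∀ z, |F z| ≤ C) (h : ℝ≥0)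
    (p : (ℝ × ℂ) × WienerPair) : |stepKernel F h p| ≤ 2 * C := by
  unfold stepKernel
  rw [abs_mul]
  have h1 : |max (-1) (min 1 p.1.1)| ≤ 1 := abs_le.2 ⟨by simp, by simp⟩
  have h2 : |F (orbmStep p.1.2 h p.2) - F p.1.2| ≤ 2 * C := by
    have := hC (orbmStep p.1.2 h p.2); have := hC p.1.2
    calc _ ≤ |F (orbmStep p.1.2 h p.2)| + |F p.1.2| := abs_sub _ _
      _ ≤ 2 * C := by linarith
  calc |max (-1) (min 1 p.1.1)| * |F (orbmStep p.1.2 h p.2) - F p.1.2| ≤ 1 * (2 * C) :=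
        mul_le_mul h1 h2 (abs_nonneg _) zero_le_one
    _ = 2 * C := one_mul _

/-- The clamp is the identity on indicator values. [folklore] -/
theorem clamp_indicator (A : Set WienerPair) (ω : WienerPair) :
    max (-1) (min 1 (A.indicator (1 : WienerPair → ℝ) ω)) = A.indicator 1 ω := by
  by_cases hω : ω ∈ A
  · simp [indicator_of_mem hω]
  · simp [indicator_of_notMem hω]

/-- **The one-step identity**: for an event `A` in the past of the pair at time `s` and a bounded
measurable `F`, `E[𝟙_A (F(Z_{s+h}) − F(Z_s))] = E[𝟙_A G_h(Z_s)]` (flow identity + Markov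
factorisation). [cite: WernerStFlour2004, Ch. 5 §5.1] -/
theorem integral_indicator_mul_sub_eq {F : ℂ → ℝ} (hFm : Measurable F) {C : ℝ} (hC : ∀ z, |F z| ≤ C)
    (s h : ℝ≥0) {A : Set WienerPair}
    (hA : MeasurableSet[MeasurableSpace.comap (pairPast s) inferInstance] A) :
    ∫ ω, A.indicator 1 ω * (F (canORBM (s + h) ω) - F (canORBM s ω)) ∂wienerPair =
      ∫ ω, A.indicator 1 ω * oneStep F h (canORBM s ω) ∂wienerPair := by
  haveI := isProbabilityMeasure_preWienerMeasure'
  have hξm : Measurable[MeasurableSpace.comap (pairPast s) inferInstance]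
      fun ω ↦ (A.indicator (1 : WienerPair → ℝ) ω, canORBM s ω) :=
    ((measurable_indicator_const_iff 1).2 hA).prodMk (measurable_comap_pairPast_canORBM le_rfl)
  have key := integral_comp_pairShift_eq s hξm (measurable_stepKernel hFm h) (abs_stepKernel_le hC h)
  have lhs : ∀ ω, stepKernel F h ((A.indicator (1 : WienerPair → ℝ) ω, canORBM s ω), pairShift s ω) =
      A.indicator 1 ω * (F (canORBM (s + h) ω) - F (canORBM s ω)) := by
    intro ω
    rw [stepKernel, clamp_indicator, canORBM_add]
  have hint : ∀ z, Integrable (fun ω' ↦ F (orbmStep z h (pairPath ω'))) wienerPair := fun z ↦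
    Integrable.of_bound ((hFm.comp ((measurable_orbmStep_right z h).comp
      measurable_pairPath)).aestronglyMeasurable) C
      (ae_of_all _ fun ω' ↦ by rw [Real.norm_eq_abs]; exact hC _)
  have rhs : ∀ ω, (∫ ω', stepKernel F h ((A.indicator (1 : WienerPair → ℝ) ω, canORBM s ω), pairPath ω')
      ∂wienerPair) = A.indicator 1 ω * oneStep F h (canORBM s ω) := by
    intro ω
    simp only [stepKernel, clamp_indicator, oneStep]
    rw [integral_const_mul, integral_sub (hint _) (integrable_const _), integral_const, smul_eq_mul,
      probReal_univ, one_mul]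
  simp_rw [lhs, rhs] at key
  exact key

/-! ### The event `{s < canHit M}` belongs to the past at time `s` -/

/-- The running maximum of the level over the dyadic grid of `[0, s]`. [folklore] -/
def levelRunMax (s : ℝ≥0) (ω : WienerPair) : ℝ := ⨆ q : ℕ × ℕ, canLevel (dyadTime s q.1 q.2) ω

/-- `levelRunMax s < M ↔ ∀ r ≤ s, canLevel r < M`. [folklore] -/
theorem levelRunMax_lt_iff {s : ℝ≥0} {ω : WienerPair} {M : ℝ} :
    levelRunMax s ω < M ↔ ∀ r ≤ s, canLevel r ω < M :=
  pathRunMax_lt_iff (p := fun r ↦ canLevel r ω) (continuous_canLevel ω)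

/-- `{s < canHit M} = {levelRunMax s < M}` (the level stays `< M` on `[0, s]`). [folklore] -/
theorem coe_lt_canHit_iff {s : ℝ≥0} {ω : WienerPair} {M : ℝ} :
    (s : WithTop ℝ≥0) < canHit M ω ↔ levelRunMax s ω < M := by
  rw [levelRunMax_lt_iff, ← not_le, canHit, exitTime_le_coe_iff (continuous_canLevel ω)]
  push Not
  refine forall₂_congr fun r _ ↦ ?_
  constructor
  · intro h; exact h.2
  · intro h; exact ⟨by linarith [canLevel_nonneg r ω], h⟩

/-- **`{s < canHit M}` is in the past at time `s`.** [folklore] -/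
theorem measurableSet_comap_coe_lt_canHit (s : ℝ≥0) (M : ℝ) :
    MeasurableSet[MeasurableSpace.comap (pairPast s) inferInstance]
      {ω | (s : WithTop ℝ≥0) < canHit M ω} := by
  have hmeas : Measurable[MeasurableSpace.comap (pairPast s) inferInstance] (levelRunMax s) :=
    Measurable.iSup fun q ↦ measurable_comap_pairPast_canLevel (dyadTime_le s q.1 q.2)
  have : {ω | (s : WithTop ℝ≥0) < canHit M ω} = {ω | levelRunMax s ω < M} := by
    ext ω; exact coe_lt_canHit_iff
  rw [this]
  exact measurableSet_lt hmeas measurable_const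

/-- `{s < canHit M}` is measurable. [folklore] -/
theorem measurableSet_coe_lt_canHit (s : ℝ≥0) (M : ℝ) :
    MeasurableSet {ω | (s : WithTop ℝ≥0) < canHit M ω} :=
  (measurableSet_comap_coe_lt_canHit s M) |> ((measurable_pairPast s).comap_le) _

/-! ### Test functions: uniform second-order Taylor data on a level region of the wedge -/

/-- The level region `{x ≥ 0, y ≥ 0, x + y ≤ M}` of the closed wedge (the closed triangle of
size `M`, in quadrant coordinates). [folklore] -/
def levelRegion (M : ℝ) : Set ℂ := {z | 0 ≤ quadX z ∧ 0 ≤ quadY z ∧ quadX z + quadY z ≤ M}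

/-- Auxiliary statement (`levelRegion_mono`). [folklore] -/
theorem levelRegion_mono {M M' : ℝ} (h : M ≤ M') : levelRegion M ⊆ levelRegion M' :=
  fun _ hz ↦ ⟨hz.1, hz.2.1, hz.2.2.trans h⟩

/-- **Test data for the Dynkin identity of the reflected process**: a bounded measurable
`F : ℂ → ℝ` with uniform second-order Taylor data `(f₁, f₂; f₁₁, f₁₂, f₂₂)` on the level region
`levelRegion M'` (remainder `≤ ω(|Δ|)|Δ|²` with a bounded monotone modulus `ω → 0`), harmonic
there (`f₁₁ + f₂₂ = 0`), and satisfying the oblique boundary conditions in Lipschitz form: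
`|∂_ζ F| ≤ C₂ · y` and `|∂_1 F| ≤ C₂ · x` (so `∂_ζ F = 0` on the side `y = 0` and `∂_1 F = 0`
on the side `x = 0`). [folklore] -/
structure OrbmTestData (M' : ℝ) where
  /-- the test function -/
  F : ℂ → ℝ
  /-- first-order data (partial derivatives in `re`, `im`) -/
  f₁ : ℂ → ℝ
  f₂ : ℂ → ℝ
  /-- second-order data -/
  f₁₁ : ℂ → ℝ
  f₁₂ : ℂ → ℝ
  f₂₂ : ℂ → ℝ
  /-- constants: global bound, derivative bound, boundary-condition constant, modulus bound -/
  C_F : ℝ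
  C₁ : ℝ
  C₂ : ℝ
  ωbar : ℝ
  /-- modulus of the Taylor remainder -/
  ω : ℝ → ℝ
  measurableF : Measurable F
  absF_le : ∀ z, |F z| ≤ C_F
  abs_f₁_le : ∀ z ∈ levelRegion M', |f₁ z| ≤ C₁
  abs_f₂_le : ∀ z ∈ levelRegion M', |f₂ z| ≤ C₁
  abs_f₁₁_le : ∀ z ∈ levelRegion M', |f₁₁ z| ≤ C₁
  abs_f₁₂_le : ∀ z ∈ levelRegion M', |f₁₂ z| ≤ C₁
  abs_f₂₂_le : ∀ z ∈ levelRegion M', |f₂₂ z| ≤ C₁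
  harmonic : ∀ z ∈ levelRegion M', f₁₁ z + f₂₂ z = 0
  bc₁ : ∀ z ∈ levelRegion M', |f₁ z / 2 + Real.sqrt 3 / 2 * f₂ z| ≤ C₂ * quadY z
  bc₂ : ∀ z ∈ levelRegion M', |f₁ z| ≤ C₂ * quadX z
  C₁_nonneg : 0 ≤ C₁
  C₂_nonneg : 0 ≤ C₂
  ω_nonneg : ∀ r, 0 ≤ ω r
  ω_mono : Monotone ω
  ω_le : ∀ r, ω r ≤ ωbar
  ω_tendsto : Tendsto ω (𝓝[>] 0) (𝓝 0)
  taylor : ∀ z ∈ levelRegion M', ∀ z' ∈ levelRegion M',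
    |F z' - F z - (f₁ z * (z' - z).re + f₂ z * (z' - z).im)
      - (f₁₁ z * (z' - z).re ^ 2 + 2 * f₁₂ z * (z' - z).re * (z' - z).im + f₂₂ z * (z' - z).im ^ 2) / 2|
      ≤ ω ‖z' - z‖ * ‖z' - z‖ ^ 2

namespace OrbmTestData

variable {M' : ℝ} (D : OrbmTestData M')

/-- The linear part `DF(z)[v] = f₁ v_re + f₂ v_im`. [folklore] -/
def lin (z v : ℂ) : ℝ := D.f₁ z * v.re + D.f₂ z * v.im

/-- The quadratic part `D²F(z)[v,v]`. [folklore] -/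
def quadr (z v : ℂ) : ℝ := D.f₁₁ z * v.re ^ 2 + 2 * D.f₁₂ z * v.re * v.im + D.f₂₂ z * v.im ^ 2

/-- Auxiliary statement (`C_F_nonneg`). [folklore] -/
theorem C_F_nonneg : 0 ≤ D.C_F := (abs_nonneg _).trans (D.absF_le 0)

/-- Auxiliary statement (`ωbar_nonneg`). [folklore] -/
theorem ωbar_nonneg : 0 ≤ D.ωbar := (D.ω_nonneg 0).trans (D.ω_le 0)

/-- The martingale increments integrate to zero: `∫ DF(z)[β_h] = 0`. [folklore] -/
theorem integral_lin_pairBM (z : ℂ) (h : ℝ≥0) : ∫ ω', D.lin z (pairBM h ω') ∂wienerPair = 0 := by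
  simp only [lin, pairBM_re, pairBM_im]
  rw [integral_add, integral_const_mul, integral_const_mul, integral_brownian_fst,
    integral_brownian_snd]
  · ring
  · exact ((integrable_brownian_fst_pow h 1).congr (by simp)).const_mul _
  · exact ((integrable_brownian_snd_pow h 1).congr (by simp)).const_mul _

/-- Integrability of `B¹_h B²_h` on the pair space. [folklore] -/
theorem integrable_brownian_fst_mul_snd (h : ℝ≥0) :
    Integrable (fun ω' : WienerPair ↦ brownian h ω'.1 * brownian h ω'.2) wienerPair := by
  have hm : AEStronglyMeasurable (fun ω' : WienerPair ↦ brownian h ω'.1 * brownian h ω'.2) wienerPair :=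
    (((measurable_brownian h).comp measurable_fst).mul
      ((measurable_brownian h).comp measurable_snd)).aestronglyMeasurable
  have hdom : Integrable (fun ω' : WienerPair ↦ brownian h ω'.1 ^ 2 + brownian h ω'.2 ^ 2) wienerPair :=
    (integrable_brownian_fst_pow h 2).add (integrable_brownian_snd_pow h 2)
  refine Integrable.mono' hdom hm (ae_of_all _ fun ω' ↦ ?_)
  rw [Real.norm_eq_abs, abs_mul]
  nlinarith [abs_nonneg (brownian h ω'.1), abs_nonneg (brownian h ω'.2),
    sq_abs (brownian h ω'.1), sq_abs (brownian h ω'.2),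
    sq_nonneg (|brownian h ω'.1| - |brownian h ω'.2|)]

/-- `∫ D²F(z)[β_h, β_h] = (f₁₁ + f₂₂) h` (`= 0` at harmonic points). [folklore] -/
theorem integral_quadr_pairBM (z : ℂ) (h : ℝ≥0) :
    ∫ ω', D.quadr z (pairBM h ω') ∂wienerPair = (D.f₁₁ z + D.f₂₂ z) * h := by
  simp only [quadr, pairBM_re, pairBM_im]
  have h1 : Integrable (fun ω' : WienerPair ↦ D.f₁₁ z * brownian h ω'.1 ^ 2) wienerPair :=
    (integrable_brownian_fst_pow h 2).const_mul _
  have h2 : Integrable (fun ω' : WienerPair ↦ 2 * D.f₁₂ z * brownian h ω'.1 * brownian h ω'.2)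
      wienerPair := by
    refine ((integrable_brownian_fst_mul_snd h).const_mul (2 * D.f₁₂ z)).congr (ae_of_all _ fun ω' ↦ ?_)
    simp only; ring
  have h3 : Integrable (fun ω' : WienerPair ↦ D.f₂₂ z * brownian h ω'.2 ^ 2) wienerPair :=
    (integrable_brownian_snd_pow h 2).const_mul _
  have h12 : Integrable (fun ω' : WienerPair ↦ D.f₁₁ z * brownian h ω'.1 ^ 2 +
      2 * D.f₁₂ z * brownian h ω'.1 * brownian h ω'.2) wienerPair := h1.add h2
  rw [integral_add h12 h3, integral_add h1 h2, integral_const_mul, integral_const_mul,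
    integral_brownian_fst_sq, integral_brownian_snd_sq]
  have : ∫ ω' : WienerPair, 2 * D.f₁₂ z * brownian h ω'.1 * brownian h ω'.2 ∂wienerPair = 0 := by
    have := integral_brownian_fst_mul_brownian_snd h h
    calc ∫ ω' : WienerPair, 2 * D.f₁₂ z * brownian h ω'.1 * brownian h ω'.2 ∂wienerPair
        = ∫ ω' : WienerPair, (2 * D.f₁₂ z) * (brownian h ω'.1 * brownian h ω'.2) ∂wienerPair := by
          congr 1; funext ω'; ring
      _ = 0 := by rw [integral_const_mul, this, mul_zero]
  rw [this]
  ring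

/-! ### The one-step error and its pointwise bound -/

/-- The centred one-step error `E(ω') = F(z') − F(z) − DF(z)[β_h] − ½ D²F(z)[β_h, β_h]`.
[folklore] -/
def stepErr (z : ℂ) (h : ℝ≥0) (ω' : WienerPair) : ℝ :=
  D.F (orbmStep z h (pairPath ω')) - D.F z - D.lin z (pairBM h ω') - D.quadr z (pairBM h ω') / 2

/-- Auxiliary statement (`measurable_stepErr`). [folklore] -/
theorem measurable_stepErr (z : ℂ) (h : ℝ≥0) : Measurable (D.stepErr z h) := by
  unfold stepErr lin quadr
  have h0 : Measurable fun ω' : WienerPair ↦ D.F (orbmStep z h (pairPath ω')) :=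
    D.measurableF.comp ((measurable_orbmStep_right z h).comp measurable_pairPath)
  have h1 : Measurable fun ω' : WienerPair ↦ (pairBM h ω').re :=
    Complex.measurable_re.comp (measurable_pairBM h)
  have h2 : Measurable fun ω' : WienerPair ↦ (pairBM h ω').im :=
    Complex.measurable_im.comp (measurable_pairBM h)
  fun_prop

/-- **The one-step expectation is the integral of the centred error** at a harmonic point:
`G_h(z) = ∫ E` (since `∫ DF(z)[β_h] = 0` and `∫ D²F(z)[β_h,β_h] = (f₁₁+f₂₂) h = 0`). [folklore] -/
theorem oneStep_eq_integral_stepErr {z : ℂ} (hz : z ∈ levelRegion M') (h : ℝ≥0) :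
    oneStep D.F h z = ∫ ω', D.stepErr z h ω' ∂wienerPair := by
  haveI := isProbabilityMeasure_preWienerMeasure'
  have hF : Integrable (fun ω' ↦ D.F (orbmStep z h (pairPath ω'))) wienerPair :=
    Integrable.of_bound ((D.measurableF.comp ((measurable_orbmStep_right z h).comp
      measurable_pairPath)).aestronglyMeasurable) D.C_F
      (ae_of_all _ fun ω' ↦ by rw [Real.norm_eq_abs]; exact D.absF_le _)
  have hlin : Integrable (fun ω' ↦ D.lin z (pairBM h ω')) wienerPair := by
    simp only [lin, pairBM_re, pairBM_im]
    exact (((integrable_brownian_fst_pow h 1).congr (by simp)).const_mul _).add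
      (((integrable_brownian_snd_pow h 1).congr (by simp)).const_mul _)
  have hquad : Integrable (fun ω' ↦ D.quadr z (pairBM h ω') / 2) wienerPair := by
    have hm : AEStronglyMeasurable (fun ω' ↦ D.quadr z (pairBM h ω') / 2) wienerPair := by
      have h1 : Measurable fun ω' : WienerPair ↦ (pairBM h ω').re :=
        Complex.measurable_re.comp (measurable_pairBM h)
      have h2 : Measurable fun ω' : WienerPair ↦ (pairBM h ω').im :=
        Complex.measurable_im.comp (measurable_pairBM h)
      unfold quadr
      exact Measurable.aestronglyMeasurable (by fun_prop)
    have hdom : Integrable (fun ω' : WienerPair ↦ (|D.f₁₁ z| + |D.f₁₂ z| + |D.f₂₂ z|) *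
        (brownian h ω'.1 ^ 2 + brownian h ω'.2 ^ 2)) wienerPair :=
      ((integrable_brownian_fst_pow h 2).add (integrable_brownian_snd_pow h 2)).const_mul _
    refine Integrable.mono' hdom hm (ae_of_all _ fun ω' ↦ ?_)
    simp only [quadr, pairBM_re, pairBM_im, Real.norm_eq_abs]
    set p := brownian h ω'.1; set q := brownian h ω'.2
    have hpq : 2 * |p * q| ≤ p ^ 2 + q ^ 2 := by
      rw [abs_mul]; nlinarith [abs_nonneg p, abs_nonneg q, sq_abs p, sq_abs q, sq_nonneg (|p| - |q|)]
    have e1 : |D.f₁₁ z * p ^ 2| = |D.f₁₁ z| * p ^ 2 := by rw [abs_mul, abs_of_nonneg (sq_nonneg p)]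
    have e3 : |D.f₂₂ z * q ^ 2| = |D.f₂₂ z| * q ^ 2 := by rw [abs_mul, abs_of_nonneg (sq_nonneg q)]
    have e2 : |2 * D.f₁₂ z * p * q| ≤ |D.f₁₂ z| * (p ^ 2 + q ^ 2) := by
      rw [show 2 * D.f₁₂ z * p * q = D.f₁₂ z * (2 * (p * q)) by ring, abs_mul, abs_mul, abs_two]
      exact mul_le_mul_of_nonneg_left hpq (abs_nonneg _)
    have htot : |D.f₁₁ z * p ^ 2 + 2 * D.f₁₂ z * p * q + D.f₂₂ z * q ^ 2| ≤
        (|D.f₁₁ z| + |D.f₁₂ z| + |D.f₂₂ z|) * (p ^ 2 + q ^ 2) := by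
      refine (abs_add_three _ _ _).trans ?_
      rw [e1, e3]
      nlinarith [abs_nonneg (D.f₁₁ z), abs_nonneg (D.f₂₂ z), sq_nonneg p, sq_nonneg q, e2]
    rw [abs_div, abs_two]
    have h0 : 0 ≤ |D.f₁₁ z * p ^ 2 + 2 * D.f₁₂ z * p * q + D.f₂₂ z * q ^ 2| := abs_nonneg _
    linarith
  have hA : Integrable (fun ω' ↦ D.F (orbmStep z h (pairPath ω')) - D.F z) wienerPair :=
    hF.sub (integrable_const _)
  have hB : Integrable (fun ω' ↦ D.F (orbmStep z h (pairPath ω')) - D.F z - D.lin z (pairBM h ω'))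
      wienerPair := hA.sub hlin
  unfold oneStep stepErr
  rw [integral_sub hB hquad, integral_sub hA hlin, integral_sub hF (integrable_const _), integral_const,
    smul_eq_mul, probReal_univ, one_mul, D.integral_lin_pairBM, MeasureTheory.integral_div,
    D.integral_quadr_pairBM, D.harmonic z hz]
  ring

end OrbmTestData

/-! ### The good event and the size of the step -/

/-- On the good event `goodEvent (a/2) h` the step size is at most `a`. [folklore] -/
theorem stepSup_le_of_mem_goodEvent {a : ℝ} {h : ℝ≥0} {ω' : WienerPair} (hω : ω' ∈ goodEvent (a / 2) h) :
    stepSup h ω' ≤ a := by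
  have h1 : runSup h ω'.1 ≤ a / 2 :=
    ciSup_le fun q ↦ (abs_brownian_le_of_mem_goodEvent hω (dyadTime_le h q.1 q.2)).1
  have h2 : runSup h ω'.2 ≤ a / 2 :=
    ciSup_le fun q ↦ (abs_brownian_le_of_mem_goodEvent hω (dyadTime_le h q.1 q.2)).2
  unfold stepSup; linarith

/-- Off the good event the step size exceeds `a/2`. [folklore] -/
theorem lt_stepSup_of_notMem_goodEvent {a : ℝ} {h : ℝ≥0} {ω' : WienerPair}
    (hω : ω' ∉ goodEvent (a / 2) h) : a / 2 < stepSup h ω' := by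
  simp only [goodEvent, mem_setOf_eq, not_forall, not_and_or, not_le] at hω
  obtain ⟨n, m, hmn, hω⟩ := hω
  have hr1 := runSup_nonneg h ω'.1
  have hr2 := runSup_nonneg h ω'.2
  unfold stepSup
  rcases hω with h1 | h2
  · have := abs_brownian_le_runSup hmn ω'.1; linarith
  · have := abs_brownian_le_runSup hmn ω'.2; linarith

/-- **One step stays in the larger region**: from `z ∈ levelRegion M` with step size `≤ a` and
`M + 8a ≤ M'`, the new position is in `levelRegion M'`. [folklore] -/
theorem orbmStep_mem_levelRegion {M M' a : ℝ} {z : ℂ} (hz : z ∈ levelRegion M) {h : ℝ≥0}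
    {ω' : WienerPair} (hS : stepSup h ω' ≤ a) (hMa : M + 8 * a ≤ M') :
    orbmStep z h (pairPath ω') ∈ levelRegion M' := by
  obtain ⟨hx, hy, hl⟩ := hz
  have hcx : Continuous fun u ↦ quadX z + quadX (pairBM u ω') :=
    continuous_const.add (continuous_quadX_pairBM ω')
  have hcy : Continuous fun u ↦ quadY z + quadY (pairBM u ω') :=
    continuous_const.add (continuous_quadY_pairBM ω')
  have hX := quadX_orbmStep_pairPath z h ω'
  have hY := quadY_orbmStep_pairPath z h ω'
  have hbx := (abs_quad_pairBM_le (le_refl h) ω').1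
  have hby := (abs_quad_pairBM_le (le_refl h) ω').2
  have hl1 : stepL₁ z h ω' ≤ 2 * stepSup h ω' := stepL₁_le hy
  have hl2 : stepL₂ z h ω' ≤ 2 * stepSup h ω' := stepL₂_le hx
  have hn1 : -(quadY z + quadY (pairBM h ω')) ≤ stepL₁ z h ω' := neg_le_skorokhodBdry hcy (le_refl h)
  have hn2 : -(quadX z + quadX (pairBM h ω')) ≤ stepL₂ z h ω' := neg_le_skorokhodBdry hcx (le_refl h)
  refine ⟨?_, ?_, ?_⟩
  · rw [hX]; linarith
  · rw [hY]; linarith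
  · rw [hX, hY]
    have h1 := abs_le.1 hbx
    have h2 := abs_le.1 hby
    linarith [h1.2, h2.2]

namespace OrbmTestData

variable {M' : ℝ} (D : OrbmTestData M')

/-- The sum of the two near-side indicators `𝟙{y(z) < 2S} + 𝟙{x(z) < 2S}`. [folklore] -/
def nearSides (z : ℂ) (h : ℝ≥0) (ω' : WienerPair) : ℝ :=
  {ω' | quadY z < 2 * stepSup h ω'}.indicator 1 ω' + {ω' | quadX z < 2 * stepSup h ω'}.indicator 1 ω'

/-- Auxiliary statement (`nearSides_nonneg`). [folklore] -/
theorem nearSides_nonneg (z : ℂ) (h : ℝ≥0) (ω' : WienerPair) : 0 ≤ nearSides z h ω' := by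
  unfold nearSides
  exact add_nonneg (indicator_nonneg (fun _ _ ↦ zero_le_one) _) (indicator_nonneg (fun _ _ ↦ zero_le_one) _)

/-- Auxiliary statement (`nearSides_le_two`). [folklore] -/
theorem nearSides_le_two (z : ℂ) (h : ℝ≥0) (ω' : WienerPair) : nearSides z h ω' ≤ 2 := by
  unfold nearSides
  have h1 : {ω' | quadY z < 2 * stepSup h ω'}.indicator (1 : WienerPair → ℝ) ω' ≤ 1 :=
    indicator_le_self' (fun _ _ ↦ zero_le_one) ω'
  have h2 : {ω' | quadX z < 2 * stepSup h ω'}.indicator (1 : WienerPair → ℝ) ω' ≤ 1 :=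
    indicator_le_self' (fun _ _ ↦ zero_le_one) ω'
  linarith

/-- Pure-real bound for the first-order boundary correction. [folklore] -/
theorem lin_correction_bound {l₁ l₂ g₁ g₂ C₂ x y S i₁ i₂ : ℝ} (hl₁ : 0 ≤ l₁) (hl₂ : 0 ≤ l₂)
    (hC₂ : 0 ≤ C₂) (hg₁ : |g₁| ≤ C₂ * y) (hg₂ : |g₂| ≤ C₂ * x)
    (hp₁ : y * l₁ ≤ 4 * S ^ 2 * i₁) (hp₂ : x * l₂ ≤ 4 * S ^ 2 * i₂) :
    |l₁ * g₁ + l₂ * g₂| ≤ 4 * C₂ * S ^ 2 * (i₁ + i₂) := by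
  calc |l₁ * g₁ + l₂ * g₂| ≤ |l₁ * g₁| + |l₂ * g₂| := abs_add_le _ _
    _ = l₁ * |g₁| + l₂ * |g₂| := by rw [abs_mul, abs_mul, abs_of_nonneg hl₁, abs_of_nonneg hl₂]
    _ ≤ l₁ * (C₂ * y) + l₂ * (C₂ * x) := by gcongr
    _ = C₂ * (y * l₁) + C₂ * (x * l₂) := by ring
    _ ≤ C₂ * (4 * S ^ 2 * i₁) + C₂ * (4 * S ^ 2 * i₂) := by gcongr
    _ = 4 * C₂ * S ^ 2 * (i₁ + i₂) := by ring

/-- Pure-real bound for the second-order boundary correction. [folklore] -/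
theorem quad_correction_bound {a₁₁ a₁₂ a₂₂ C₁ p q S w₁ w₂ L J : ℝ}
    (h₁₁ : |a₁₁| ≤ C₁) (h₁₂ : |a₁₂| ≤ C₁) (h₂₂ : |a₂₂| ≤ C₁) (hC₁ : 0 ≤ C₁)
    (hp : |p| ≤ S) (hq : |q| ≤ S) (hS : 0 ≤ S) (hw₁ : |w₁| ≤ L) (hw₂ : |w₂| ≤ L)
    (hL0 : 0 ≤ L) (hL4 : L ≤ 4 * S) (hLJ : L ≤ 2 * S * J) :
    |a₁₁ * (2 * p * w₁ + w₁ ^ 2) + 2 * a₁₂ * (p * w₂ + q * w₁ + w₁ * w₂) + a₂₂ * (2 * q * w₂ + w₂ ^ 2)|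
      ≤ 48 * C₁ * S ^ 2 * J := by
  have t1 : |2 * p * w₁ + w₁ ^ 2| ≤ 2 * S * L + L ^ 2 := by
    calc |2 * p * w₁ + w₁ ^ 2| ≤ |2 * p * w₁| + |w₁ ^ 2| := abs_add_le _ _
      _ = 2 * |p| * |w₁| + |w₁| ^ 2 := by rw [abs_mul, abs_mul, abs_two, abs_pow]
      _ ≤ 2 * S * L + L ^ 2 := by gcongr
  have t2 : |p * w₂ + q * w₁ + w₁ * w₂| ≤ S * L + S * L + L ^ 2 := by
    calc |p * w₂ + q * w₁ + w₁ * w₂| ≤ |p * w₂| + |q * w₁| + |w₁ * w₂| := abs_add_three _ _ _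
      _ = |p| * |w₂| + |q| * |w₁| + |w₁| * |w₂| := by rw [abs_mul, abs_mul, abs_mul]
      _ ≤ S * L + S * L + L * L := by gcongr
      _ = _ := by ring
  have t3 : |2 * q * w₂ + w₂ ^ 2| ≤ 2 * S * L + L ^ 2 := by
    calc |2 * q * w₂ + w₂ ^ 2| ≤ |2 * q * w₂| + |w₂ ^ 2| := abs_add_le _ _
      _ = 2 * |q| * |w₂| + |w₂| ^ 2 := by rw [abs_mul, abs_mul, abs_two, abs_pow]
      _ ≤ 2 * S * L + L ^ 2 := by gcongr
  have hSL : 8 * S * L + 4 * L ^ 2 ≤ 24 * (S * L) := by nlinarith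
  calc |a₁₁ * (2 * p * w₁ + w₁ ^ 2) + 2 * a₁₂ * (p * w₂ + q * w₁ + w₁ * w₂) + a₂₂ * (2 * q * w₂ + w₂ ^ 2)|
      ≤ |a₁₁ * (2 * p * w₁ + w₁ ^ 2)| + |2 * a₁₂ * (p * w₂ + q * w₁ + w₁ * w₂)| +
        |a₂₂ * (2 * q * w₂ + w₂ ^ 2)| := abs_add_three _ _ _
    _ = |a₁₁| * |2 * p * w₁ + w₁ ^ 2| + 2 * |a₁₂| * |p * w₂ + q * w₁ + w₁ * w₂| +
        |a₂₂| * |2 * q * w₂ + w₂ ^ 2| := by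
        rw [abs_mul, abs_mul, abs_mul, abs_mul, abs_two]
    _ ≤ C₁ * (2 * S * L + L ^ 2) + 2 * C₁ * (S * L + S * L + L ^ 2) + C₁ * (2 * S * L + L ^ 2) := by
        gcongr
    _ = C₁ * (8 * S * L + 4 * L ^ 2) := by ring
    _ ≤ C₁ * (24 * (S * L)) := mul_le_mul_of_nonneg_left hSL hC₁
    _ ≤ C₁ * (24 * (S * (2 * S * J))) := by gcongr
    _ = 48 * C₁ * S ^ 2 * J := by ring

/-- The displacement of the step from a fresh path and its real and imaginary parts. [folklore] -/
theorem orbmStep_pairPath_sub (z : ℂ) (h : ℝ≥0) (ω' : WienerPair) :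
    orbmStep z h (pairPath ω') - z =
      pairBM h ω' + dirSixty * ((stepL₁ z h ω' : ℝ) : ℂ) + ((stepL₂ z h ω' : ℝ) : ℂ) ∧
    (orbmStep z h (pairPath ω') - z).re = (pairBM h ω').re + (stepL₁ z h ω' / 2 + stepL₂ z h ω') ∧
    (orbmStep z h (pairPath ω') - z).im = (pairBM h ω').im + Real.sqrt 3 / 2 * stepL₁ z h ω' := by
  have hΔ : orbmStep z h (pairPath ω') - z =
      pairBM h ω' + dirSixty * ((stepL₁ z h ω' : ℝ) : ℂ) + ((stepL₂ z h ω' : ℝ) : ℂ) := by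
    rw [orbmStep_pairPath]; ring
  refine ⟨hΔ, ?_, ?_⟩
  · rw [hΔ, dirSixty_eq]; simp; try ring
  · rw [hΔ, dirSixty_eq]; simp; try ring

/-- `‖ζ‖ = 1`. [folklore] -/
theorem norm_dirSixty : ‖dirSixty‖ = 1 := by
  rw [dirSixty]; exact Complex.norm_exp_ofReal_mul_I _

/-- The displacement has norm at most `5 stepSup` (for `z` with non-negative coordinates).
[folklore] -/
theorem norm_orbmStep_sub_le {z : ℂ} (hx : 0 ≤ quadX z) (hy : 0 ≤ quadY z) (h : ℝ≥0) (ω' : WienerPair) :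
    ‖orbmStep z h (pairPath ω') - z‖ ≤ 5 * stepSup h ω' := by
  obtain ⟨hΔ, -, -⟩ := orbmStep_pairPath_sub z h ω'
  have hl₁0 := stepL₁_nonneg z h ω'
  have hl₂0 := stepL₂_nonneg z h ω'
  have hl₁ := stepL₁_le (h := h) (ω' := ω') hy
  have hl₂ := stepL₂_le (h := h) (ω' := ω') hx
  have hβ := norm_pairBM_le_stepSup h ω'
  rw [hΔ]
  calc ‖pairBM h ω' + dirSixty * ((stepL₁ z h ω' : ℝ) : ℂ) + ((stepL₂ z h ω' : ℝ) : ℂ)‖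
      ≤ ‖pairBM h ω' + dirSixty * ((stepL₁ z h ω' : ℝ) : ℂ)‖ + ‖((stepL₂ z h ω' : ℝ) : ℂ)‖ := norm_add_le _ _
    _ ≤ ‖pairBM h ω'‖ + ‖dirSixty * ((stepL₁ z h ω' : ℝ) : ℂ)‖ + ‖((stepL₂ z h ω' : ℝ) : ℂ)‖ := by
        gcongr; exact norm_add_le _ _
    _ = ‖pairBM h ω'‖ + stepL₁ z h ω' + stepL₂ z h ω' := by
        rw [norm_mul, norm_dirSixty, one_mul, Complex.norm_real, Complex.norm_real,
          Real.norm_of_nonneg hl₁0, Real.norm_of_nonneg hl₂0]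
    _ ≤ 5 * stepSup h ω' := by linarith

set_option maxHeartbeats 400000 in
/-- **Pointwise bound on the good event.** For `z ∈ levelRegion M`, step size `S ≤ a`,
`M + 8a ≤ M'`:
`|E| ≤ (4C₂ + 24C₁) S² (𝟙_y + 𝟙_x) + 25 ω(5S) S²`. [folklore] -/
theorem abs_stepErr_le_of_good {M a : ℝ} {z : ℂ} (hz : z ∈ levelRegion M) {h : ℝ≥0}
    {ω' : WienerPair} (hS : stepSup h ω' ≤ a) (hMa : M + 8 * a ≤ M') (ha : 0 < a) :
    |D.stepErr z h ω'| ≤ (4 * D.C₂ + 24 * D.C₁) * stepSup h ω' ^ 2 * nearSides z h ω'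
      + 25 * D.ω (5 * stepSup h ω') * stepSup h ω' ^ 2 := by
  have hzM' : z ∈ levelRegion M' := levelRegion_mono (by linarith) hz
  have hz'M' := orbmStep_mem_levelRegion hz hS hMa
  obtain ⟨hx, hy, -⟩ := hz
  obtain ⟨-, hΔre, hΔim⟩ := orbmStep_pairPath_sub z h ω'
  -- opaque names
  obtain ⟨S, hSdef⟩ : ∃ S, S = stepSup h ω' := ⟨_, rfl⟩
  obtain ⟨z', hz'⟩ : ∃ z', z' = orbmStep z h (pairPath ω') := ⟨_, rfl⟩
  obtain ⟨p, hp⟩ : ∃ p, p = (pairBM h ω').re := ⟨_, rfl⟩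
  obtain ⟨q, hq⟩ : ∃ q, q = (pairBM h ω').im := ⟨_, rfl⟩
  obtain ⟨l₁, hl₁⟩ : ∃ l₁, l₁ = stepL₁ z h ω' := ⟨_, rfl⟩
  obtain ⟨l₂, hl₂⟩ : ∃ l₂, l₂ = stepL₂ z h ω' := ⟨_, rfl⟩
  obtain ⟨J, hJ⟩ : ∃ J, J = nearSides z h ω' := ⟨_, rfl⟩
  rw [← hz', ← hp, ← hl₁, ← hl₂] at hΔre
  rw [← hz', ← hq, ← hl₁] at hΔim
  rw [← hSdef] at hS
  rw [← hz'] at hz'M'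
  have hS0 : 0 ≤ S := hSdef ▸ stepSup_nonneg h ω'
  have hl₁0 : 0 ≤ l₁ := hl₁ ▸ stepL₁_nonneg z h ω'
  have hl₂0 : 0 ≤ l₂ := hl₂ ▸ stepL₂_nonneg z h ω'
  have hJ0 : 0 ≤ J := hJ ▸ nearSides_nonneg z h ω'
  have hpS : |p| ≤ S := by
    rw [hp, hSdef, pairBM_re]
    exact (abs_brownian_le_runSup (le_refl h) ω'.1).trans (by unfold stepSup; linarith [runSup_nonneg h ω'.2])
  have hqS : |q| ≤ S := by
    rw [hq, hSdef, pairBM_im]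
    exact (abs_brownian_le_runSup (le_refl h) ω'.2).trans (by unfold stepSup; linarith [runSup_nonneg h ω'.1])
  have hl₁J : l₁ ≤ 2 * S * {ω' | quadY z < 2 * stepSup h ω'}.indicator 1 ω' := by
    rw [hl₁, hSdef]; exact stepL₁_le_indicator hy
  have hl₂J : l₂ ≤ 2 * S * {ω' | quadX z < 2 * stepSup h ω'}.indicator 1 ω' := by
    rw [hl₂, hSdef]; exact stepL₂_le_indicator hx
  have hLJ : l₁ + l₂ ≤ 2 * S * J := by rw [hJ]; unfold nearSides; linarith
  have hJ2 : J ≤ 2 := hJ ▸ nearSides_le_two z h ω'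
  have hL4 : l₁ + l₂ ≤ 4 * S := by nlinarith
  -- Taylor
  have hT := D.taylor z hzM' z' hz'M'
  have hΔn : ‖z' - z‖ ≤ 5 * S := by rw [hz', hSdef]; exact norm_orbmStep_sub_le hx hy h ω'
  have hω : D.ω ‖z' - z‖ * ‖z' - z‖ ^ 2 ≤ 25 * D.ω (5 * S) * S ^ 2 := by
    have h1 : D.ω ‖z' - z‖ ≤ D.ω (5 * S) := D.ω_mono hΔn
    have h2 : ‖z' - z‖ ^ 2 ≤ (5 * S) ^ 2 := pow_le_pow_left₀ (norm_nonneg _) hΔn 2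
    calc D.ω ‖z' - z‖ * ‖z' - z‖ ^ 2 ≤ D.ω (5 * S) * (5 * S) ^ 2 :=
          mul_le_mul h1 h2 (sq_nonneg _) (D.ω_nonneg _)
      _ = 25 * D.ω (5 * S) * S ^ 2 := by ring
  -- linear correction
  have hlin_bd : |l₁ * (D.f₁ z / 2 + Real.sqrt 3 / 2 * D.f₂ z) + l₂ * D.f₁ z| ≤ 4 * D.C₂ * S ^ 2 * J := by
    have p1 := quadY_mul_stepL₁_le (h := h) (ω' := ω') hy
    have p2 := quadX_mul_stepL₂_le (h := h) (ω' := ω') hx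
    rw [← hl₁, ← hSdef] at p1
    rw [← hl₂, ← hSdef] at p2
    have := lin_correction_bound hl₁0 hl₂0 D.C₂_nonneg (D.bc₁ z hzM') (D.bc₂ z hzM') p1 p2
    rw [hJ]; unfold nearSides
    exact this
  -- quadratic correction
  have hw₁ : |l₁ / 2 + l₂| ≤ l₁ + l₂ := by rw [abs_of_nonneg (by positivity)]; linarith
  have h32 : Real.sqrt 3 / 2 ≤ 1 := by
    have : Real.sqrt 3 < 2 := by
      rw [show (2 : ℝ) = Real.sqrt 4 by rw [show (4:ℝ) = 2 ^ 2 by norm_num, Real.sqrt_sq (by norm_num)]]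
      exact Real.sqrt_lt_sqrt (by norm_num) (by norm_num)
    linarith
  have hw₂ : |Real.sqrt 3 / 2 * l₁| ≤ l₁ + l₂ := by
    rw [abs_of_nonneg (by positivity)]; nlinarith [Real.sqrt_nonneg 3]
  have hquad_bd := quad_correction_bound (D.abs_f₁₁_le z hzM') (D.abs_f₁₂_le z hzM') (D.abs_f₂₂_le z hzM')
    D.C₁_nonneg hpS hqS hS0 hw₁ hw₂ (by positivity) hL4 hLJ
  -- assemble: `E = Taylor remainder + linear correction + quadratic correction / 2`
  have hdecomp : D.stepErr z h ω' =
      (D.F z' - D.F z - (D.f₁ z * (z' - z).re + D.f₂ z * (z' - z).im)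
        - (D.f₁₁ z * (z' - z).re ^ 2 + 2 * D.f₁₂ z * (z' - z).re * (z' - z).im
            + D.f₂₂ z * (z' - z).im ^ 2) / 2)
      + (l₁ * (D.f₁ z / 2 + Real.sqrt 3 / 2 * D.f₂ z) + l₂ * D.f₁ z)
      + (D.f₁₁ z * (2 * p * (l₁ / 2 + l₂) + (l₁ / 2 + l₂) ^ 2)
          + 2 * D.f₁₂ z * (p * (Real.sqrt 3 / 2 * l₁) + q * (l₁ / 2 + l₂)
              + (l₁ / 2 + l₂) * (Real.sqrt 3 / 2 * l₁))
          + D.f₂₂ z * (2 * q * (Real.sqrt 3 / 2 * l₁) + (Real.sqrt 3 / 2 * l₁) ^ 2)) / 2 := by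
    simp only [stepErr, lin, quadr, ← hz', ← hp, ← hq, hΔre, hΔim]; ring
  rw [hdecomp, ← hSdef, ← hJ]
  refine (abs_add_three _ _ _).trans ?_
  rw [abs_div, abs_two]
  have e1 := hT.trans hω
  linarith [e1, hlin_bd, hquad_bd]

/-- **Crude pointwise bound**: `|E| ≤ 2C_F + 2C₁ S + 2C₁ S²` for `z ∈ levelRegion M'`
(used off the good event). [folklore] -/
theorem abs_stepErr_le_crude {z : ℂ} (hz : z ∈ levelRegion M') (h : ℝ≥0) (ω' : WienerPair) :
    |D.stepErr z h ω'| ≤ 2 * D.C_F + 2 * D.C₁ * stepSup h ω' + 2 * D.C₁ * stepSup h ω' ^ 2 := by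
  set S := stepSup h ω' with hSdef
  have hS0 : 0 ≤ S := stepSup_nonneg h ω'
  have hβre : |(pairBM h ω').re| ≤ S := by
    rw [pairBM_re]; exact (abs_brownian_le_runSup (le_refl h) ω'.1).trans (by
      rw [hSdef]; unfold stepSup; linarith [runSup_nonneg h ω'.2])
  have hβim : |(pairBM h ω').im| ≤ S := by
    rw [pairBM_im]; exact (abs_brownian_le_runSup (le_refl h) ω'.2).trans (by
      rw [hSdef]; unfold stepSup; linarith [runSup_nonneg h ω'.1])
  set p := (pairBM h ω').re; set q := (pairBM h ω').im
  have hC₁ := D.C₁_nonneg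
  have c1 := D.abs_f₁_le z hz; have c2 := D.abs_f₂_le z hz
  have c11 := D.abs_f₁₁_le z hz; have c12 := D.abs_f₁₂_le z hz; have c22 := D.abs_f₂₂_le z hz
  have hF1 := D.absF_le (orbmStep z h (pairPath ω')); have hF2 := D.absF_le z
  have hlin : |D.lin z (pairBM h ω')| ≤ 2 * D.C₁ * S := by
    simp only [lin]
    calc |D.f₁ z * p + D.f₂ z * q| ≤ |D.f₁ z * p| + |D.f₂ z * q| := abs_add_le _ _
      _ = |D.f₁ z| * |p| + |D.f₂ z| * |q| := by rw [abs_mul, abs_mul]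
      _ ≤ D.C₁ * S + D.C₁ * S := by gcongr
      _ = 2 * D.C₁ * S := by ring
  have hquad : |D.quadr z (pairBM h ω') / 2| ≤ 2 * D.C₁ * S ^ 2 := by
    simp only [quadr]
    have hpq : |p * q| ≤ S ^ 2 := by rw [abs_mul]; nlinarith [abs_nonneg p, abs_nonneg q]
    have hp2 : p ^ 2 ≤ S ^ 2 := by nlinarith [abs_nonneg p, sq_abs p]
    have hq2 : q ^ 2 ≤ S ^ 2 := by nlinarith [abs_nonneg q, sq_abs q]
    rw [abs_div, abs_two]
    calc |D.f₁₁ z * p ^ 2 + 2 * D.f₁₂ z * p * q + D.f₂₂ z * q ^ 2| / 2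
        ≤ (|D.f₁₁ z * p ^ 2| + |2 * D.f₁₂ z * p * q| + |D.f₂₂ z * q ^ 2|) / 2 := by
          gcongr; exact abs_add_three _ _ _
      _ = (|D.f₁₁ z| * p ^ 2 + 2 * |D.f₁₂ z| * |p * q| + |D.f₂₂ z| * q ^ 2) / 2 := by
          rw [abs_mul, abs_of_nonneg (sq_nonneg p), abs_mul (D.f₂₂ z), abs_of_nonneg (sq_nonneg q),
            show 2 * D.f₁₂ z * p * q = 2 * (D.f₁₂ z * (p * q)) by ring, abs_mul, abs_two, abs_mul]
          ring
      _ ≤ (D.C₁ * S ^ 2 + 2 * D.C₁ * S ^ 2 + D.C₁ * S ^ 2) / 2 := by gcongr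
      _ = 2 * D.C₁ * S ^ 2 := by ring
  unfold stepErr
  calc |D.F (orbmStep z h (pairPath ω')) - D.F z - D.lin z (pairBM h ω') - D.quadr z (pairBM h ω') / 2|
      ≤ |D.F (orbmStep z h (pairPath ω')) - D.F z - D.lin z (pairBM h ω')| + |D.quadr z (pairBM h ω') / 2| :=
        abs_sub _ _
    _ ≤ |D.F (orbmStep z h (pairPath ω')) - D.F z| + |D.lin z (pairBM h ω')| + |D.quadr z (pairBM h ω') / 2| := by
        gcongr; exact abs_sub _ _
    _ ≤ (|D.F (orbmStep z h (pairPath ω'))| + |D.F z|) + 2 * D.C₁ * S + 2 * D.C₁ * S ^ 2 := by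
        gcongr
        exact abs_sub _ _
    _ ≤ 2 * D.C_F + 2 * D.C₁ * S + 2 * D.C₁ * S ^ 2 := by linarith

end OrbmTestData

/-! ### The integrated one-step bound -/

/-- `|𝟙_s| ≤ 1`. [folklore] -/
theorem abs_indicator_one_le {α : Type*} (s : Set α) (x : α) : |s.indicator (1 : α → ℝ) x| ≤ 1 := by
  by_cases hx : x ∈ s
  · rw [indicator_of_mem hx]; simp
  · rw [indicator_of_notMem hx]; simp

/-- `0 ≤ 𝟙_s`. [folklore] -/
theorem indicator_one_nonneg {α : Type*} (s : Set α) (x : α) : 0 ≤ s.indicator (1 : α → ℝ) x := by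
  by_cases hx : x ∈ s
  · rw [indicator_of_mem hx]; simp
  · rw [indicator_of_notMem hx]

/-- `stepSup²` is integrable on the pair space. [folklore] -/
theorem integrable_stepSup_sq (h : ℝ≥0) : Integrable (fun ω' ↦ stepSup h ω' ^ 2) wienerPair := by
  have h1 : Integrable (fun ω' : WienerPair ↦ runSup h ω'.1 ^ 2) wienerPair :=
    integrable_wienerPair_fst (F := fun ω₁ ↦ runSup h ω₁ ^ 2) (integrable_runSup_sq h)
  have h2 : Integrable (fun ω' : WienerPair ↦ runSup h ω'.2 ^ 2) wienerPair :=
    integrable_wienerPair_snd (F := fun ω₂ ↦ runSup h ω₂ ^ 2) (integrable_runSup_sq h)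
  have hdom : Integrable (fun ω' : WienerPair ↦ 2 * runSup h ω'.1 ^ 2 + 2 * runSup h ω'.2 ^ 2) wienerPair :=
    (h1.const_mul 2).add (h2.const_mul 2)
  refine hdom.mono' ((measurable_stepSup h).pow_const 2).aestronglyMeasurable (ae_of_all _ fun ω' ↦ ?_)
  rw [Real.norm_eq_abs, abs_of_nonneg (sq_nonneg _)]
  unfold stepSup
  nlinarith [sq_nonneg (runSup h ω'.1 - runSup h ω'.2)]

/-- `∫ stepSup² ≤ 16 h`. [folklore] -/
theorem integral_stepSup_sq_le (h : ℝ≥0) : ∫ ω', stepSup h ω' ^ 2 ∂wienerPair ≤ 16 * (h : ℝ) := by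
  have h1 : Integrable (fun ω' : WienerPair ↦ runSup h ω'.1 ^ 2) wienerPair :=
    integrable_wienerPair_fst (F := fun ω₁ ↦ runSup h ω₁ ^ 2) (integrable_runSup_sq h)
  have h2 : Integrable (fun ω' : WienerPair ↦ runSup h ω'.2 ^ 2) wienerPair :=
    integrable_wienerPair_snd (F := fun ω₂ ↦ runSup h ω₂ ^ 2) (integrable_runSup_sq h)
  have hdom : Integrable (fun ω' : WienerPair ↦ 2 * runSup h ω'.1 ^ 2 + 2 * runSup h ω'.2 ^ 2) wienerPair :=
    (h1.const_mul 2).add (h2.const_mul 2)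
  have hle : ∫ ω', stepSup h ω' ^ 2 ∂wienerPair ≤
      ∫ ω' : WienerPair, 2 * runSup h ω'.1 ^ 2 + 2 * runSup h ω'.2 ^ 2 ∂wienerPair := by
    refine integral_mono (integrable_stepSup_sq h) hdom fun ω' ↦ ?_
    simp only [stepSup]
    nlinarith [sq_nonneg (runSup h ω'.1 - runSup h ω'.2)]
  have heq : ∫ ω' : WienerPair, 2 * runSup h ω'.1 ^ 2 + 2 * runSup h ω'.2 ^ 2 ∂wienerPair =
      2 * ∫ ω₁, runSup h ω₁ ^ 2 ∂preWienerMeasure + 2 * ∫ ω₂, runSup h ω₂ ^ 2 ∂preWienerMeasure := by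
    rw [integral_add (h1.const_mul 2) (h2.const_mul 2), integral_const_mul, integral_const_mul,
      integral_wienerPair_fst (F := fun ω₁ ↦ runSup h ω₁ ^ 2),
      integral_wienerPair_snd (F := fun ω₂ ↦ runSup h ω₂ ^ 2)]
  have := integral_runSup_sq_le h
  linarith

namespace OrbmTestData

variable {M' : ℝ} (D : OrbmTestData M')

/-- `ω ∘ (5 stepSup)` is measurable (monotone modulus). [folklore] -/
theorem measurable_ω_stepSup (h : ℝ≥0) : Measurable fun ω' ↦ D.ω (5 * stepSup h ω') :=
  D.ω_mono.measurable.comp ((measurable_stepSup h).const_mul 5)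

/-- The dominating function `Φ` of the one-step error:
`(4C₂+24C₁) S² J + 25 ω(5S) S² + 2C_F 𝟙_{Gᶜ} + 2C₁(2/a+1) S² 𝟙{a/2 < S}`. [folklore] -/
def stepDom (a : ℝ) (z : ℂ) (h : ℝ≥0) (ω' : WienerPair) : ℝ :=
  (4 * D.C₂ + 24 * D.C₁) * stepSup h ω' ^ 2 * nearSides z h ω'
    + 25 * D.ω (5 * stepSup h ω') * stepSup h ω' ^ 2
    + 2 * D.C_F * (goodEvent (a / 2) h)ᶜ.indicator 1 ω'
    + 2 * D.C₁ * (2 / a + 1) * (stepSup h ω' ^ 2 * {ω' | a / 2 < stepSup h ω'}.indicator 1 ω')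

/-- **Pointwise domination of the one-step error**, on and off the good event. [folklore] -/
theorem abs_stepErr_le_stepDom {M a : ℝ} {z : ℂ} (hz : z ∈ levelRegion M) (h : ℝ≥0)
    (hMa : M + 8 * a ≤ M') (ha : 0 < a) (ω' : WienerPair) :
    |D.stepErr z h ω'| ≤ D.stepDom a z h ω' := by
  have hzM' : z ∈ levelRegion M' := levelRegion_mono (by linarith) hz
  have hS0 := stepSup_nonneg h ω'
  have hJ0 := nearSides_nonneg z h ω'
  have hC₁ := D.C₁_nonneg; have hC₂ := D.C₂_nonneg; have hCF := D.C_F_nonneg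
  have hω0 := D.ω_nonneg (5 * stepSup h ω')
  unfold stepDom
  by_cases hG : ω' ∈ goodEvent (a / 2) h
  · have hb := D.abs_stepErr_le_of_good hz (stepSup_le_of_mem_goodEvent hG) hMa ha
    have t3 : 0 ≤ 2 * D.C_F * (goodEvent (a / 2) h)ᶜ.indicator (1 : WienerPair → ℝ) ω' :=
      mul_nonneg (by positivity) (indicator_one_nonneg _ _)
    have t4 : 0 ≤ 2 * D.C₁ * (2 / a + 1) *
        (stepSup h ω' ^ 2 * {ω' | a / 2 < stepSup h ω'}.indicator (1 : WienerPair → ℝ) ω') :=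
      mul_nonneg (by positivity) (mul_nonneg (sq_nonneg _) (indicator_one_nonneg _ _))
    linarith
  · have hb := D.abs_stepErr_le_crude hzM' h ω'
    have hlt := lt_stepSup_of_notMem_goodEvent hG
    rw [indicator_of_mem (by exact hG), indicator_of_mem (by exact hlt)]
    simp only [Pi.one_apply, mul_one]
    have t1 : 0 ≤ (4 * D.C₂ + 24 * D.C₁) * stepSup h ω' ^ 2 * nearSides z h ω' := by positivity
    have t2 : 0 ≤ 25 * D.ω (5 * stepSup h ω') * stepSup h ω' ^ 2 := by positivity
    -- `S ≤ (2/a) S²` since `S > a/2`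
    have hSS : stepSup h ω' ≤ 2 / a * stepSup h ω' ^ 2 := by
      rw [div_mul_eq_mul_div, le_div_iff₀ ha]
      nlinarith
    nlinarith [hSS, hC₁]

/-- The dominating function is integrable. [folklore] -/
theorem integrable_stepDom (a : ℝ) (z : ℂ) (h : ℝ≥0) : Integrable (D.stepDom a z h) wienerPair := by
  haveI := isProbabilityMeasure_preWienerMeasure'
  have hS2 := integrable_stepSup_sq h
  have hmS := measurable_stepSup h
  have mJ : Measurable (nearSides z h) := by
    unfold nearSides
    exact ((measurable_indicator_const_iff 1).2 (measurableSet_lt measurable_const (hmS.const_mul 2))).add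
      ((measurable_indicator_const_iff 1).2 (measurableSet_lt measurable_const (hmS.const_mul 2)))
  have h1 : Integrable (fun ω' ↦ (4 * D.C₂ + 24 * D.C₁) * stepSup h ω' ^ 2 * nearSides z h ω') wienerPair := by
    refine ((hS2.const_mul (2 * (4 * D.C₂ + 24 * D.C₁))).mono' ?_ (ae_of_all _ fun ω' ↦ ?_))
    · exact ((measurable_const.mul (hmS.pow_const 2)).mul mJ).aestronglyMeasurable
    · rw [Real.norm_eq_abs, abs_mul, abs_mul,
        abs_of_nonneg (by linarith [D.C₁_nonneg, D.C₂_nonneg] : (0:ℝ) ≤ 4 * D.C₂ + 24 * D.C₁),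
        abs_of_nonneg (sq_nonneg (stepSup h ω')), abs_of_nonneg (nearSides_nonneg z h ω')]
      have := nearSides_le_two z h ω'
      have : 0 ≤ (4 * D.C₂ + 24 * D.C₁) * stepSup h ω' ^ 2 := by
        have := D.C₁_nonneg; have := D.C₂_nonneg; positivity
      nlinarith
  have h2 : Integrable (fun ω' ↦ 25 * D.ω (5 * stepSup h ω') * stepSup h ω' ^ 2) wienerPair := by
    refine ((hS2.const_mul (25 * D.ωbar)).mono' ?_ (ae_of_all _ fun ω' ↦ ?_))
    · exact ((measurable_const.mul (D.measurable_ω_stepSup h)).mul (hmS.pow_const 2)).aestronglyMeasurable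
    · rw [Real.norm_eq_abs, abs_mul, abs_mul, show |(25:ℝ)| = 25 by norm_num,
        abs_of_nonneg (D.ω_nonneg _), abs_of_nonneg (sq_nonneg (stepSup h ω'))]
      have := D.ω_le (5 * stepSup h ω')
      have := sq_nonneg (stepSup h ω')
      nlinarith
  have h3 : Integrable (fun ω' ↦ 2 * D.C_F * (goodEvent (a / 2) h)ᶜ.indicator (1 : WienerPair → ℝ) ω')
      wienerPair :=
    ((integrable_const (1 : ℝ)).indicator (measurableSet_goodEvent _ h).compl).const_mul _
  have h4 : Integrable (fun ω' ↦ 2 * D.C₁ * (2 / a + 1) *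
      (stepSup h ω' ^ 2 * {ω' | a / 2 < stepSup h ω'}.indicator (1 : WienerPair → ℝ) ω')) wienerPair := by
    refine ((hS2.mono' ?_ (ae_of_all _ fun ω' ↦ ?_))).const_mul _
    · exact ((hmS.pow_const 2).mul ((measurable_indicator_const_iff 1).2
        (measurableSet_lt measurable_const hmS))).aestronglyMeasurable
    · rw [Real.norm_eq_abs, abs_mul, abs_of_nonneg (sq_nonneg (stepSup h ω'))]
      have := abs_indicator_one_le {ω' | a / 2 < stepSup h ω'} ω'
      nlinarith [sq_nonneg (stepSup h ω'), abs_nonneg ({ω' | a / 2 < stepSup h ω'}.indicator (1 : WienerPair → ℝ) ω')]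
  unfold stepDom
  exact ((h1.add h2).add h3).add h4

/-- **The integrated one-step bound.** For `z ∈ levelRegion M`, `M + 8a ≤ M'`, `a > 0`:
`|G_h(z)| ≤ (4C₂+24C₁) ∫ S² J_z + 25 ∫ ω(5S) S² + 2C_F P(Gᶜ) + 2C₁(2/a+1) ∫ S² 𝟙{a/2<S}`.
[folklore] -/
theorem abs_oneStep_le {M a : ℝ} {z : ℂ} (hz : z ∈ levelRegion M) (h : ℝ≥0)
    (hMa : M + 8 * a ≤ M') (ha : 0 < a) :
    |oneStep D.F h z| ≤
      (4 * D.C₂ + 24 * D.C₁) * ∫ ω', stepSup h ω' ^ 2 * nearSides z h ω' ∂wienerPair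
      + 25 * ∫ ω', D.ω (5 * stepSup h ω') * stepSup h ω' ^ 2 ∂wienerPair
      + 2 * D.C_F * wienerPair.real (goodEvent (a / 2) h)ᶜ
      + 2 * D.C₁ * (2 / a + 1) *
          ∫ ω', stepSup h ω' ^ 2 * {ω' | a / 2 < stepSup h ω'}.indicator 1 ω' ∂wienerPair := by
  haveI := isProbabilityMeasure_preWienerMeasure'
  have hzM' : z ∈ levelRegion M' := levelRegion_mono (by linarith) hz
  rw [D.oneStep_eq_integral_stepErr hzM']
  have hdom := D.integrable_stepDom a z h
  have hle : ‖∫ ω', D.stepErr z h ω' ∂wienerPair‖ ≤ ∫ ω', D.stepDom a z h ω' ∂wienerPair :=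
    norm_integral_le_of_norm_le hdom (ae_of_all _ fun ω' ↦ by
      rw [Real.norm_eq_abs]; exact D.abs_stepErr_le_stepDom hz h hMa ha ω')
  rw [Real.norm_eq_abs] at hle
  refine hle.trans (le_of_eq ?_)
  -- split the integral of the dominating function
  have hS2 := integrable_stepSup_sq h
  have hmS := measurable_stepSup h
  have mJ : Measurable (nearSides z h) := by
    unfold nearSides
    exact ((measurable_indicator_const_iff 1).2 (measurableSet_lt measurable_const (hmS.const_mul 2))).add
      ((measurable_indicator_const_iff 1).2 (measurableSet_lt measurable_const (hmS.const_mul 2)))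
  have i1 : Integrable (fun ω' ↦ stepSup h ω' ^ 2 * nearSides z h ω') wienerPair := by
    refine ((hS2.const_mul 2).mono' ((hmS.pow_const 2).mul mJ).aestronglyMeasurable
      (ae_of_all _ fun ω' ↦ ?_))
    rw [Real.norm_eq_abs, abs_mul, abs_of_nonneg (sq_nonneg (stepSup h ω')), abs_of_nonneg (nearSides_nonneg z h ω')]
    nlinarith [nearSides_le_two z h ω', sq_nonneg (stepSup h ω'), nearSides_nonneg z h ω']
  have i2 : Integrable (fun ω' ↦ D.ω (5 * stepSup h ω') * stepSup h ω' ^ 2) wienerPair := by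
    refine ((hS2.const_mul D.ωbar).mono' ((D.measurable_ω_stepSup h).mul (hmS.pow_const 2)).aestronglyMeasurable
      (ae_of_all _ fun ω' ↦ ?_))
    rw [Real.norm_eq_abs, abs_mul, abs_of_nonneg (D.ω_nonneg _), abs_of_nonneg (sq_nonneg (stepSup h ω'))]
    nlinarith [D.ω_le (5 * stepSup h ω'), sq_nonneg (stepSup h ω')]
  have i3 : Integrable (fun ω' ↦ (goodEvent (a / 2) h)ᶜ.indicator (1 : WienerPair → ℝ) ω') wienerPair :=
    (integrable_const (1 : ℝ)).indicator (measurableSet_goodEvent _ h).compl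
  have i4 : Integrable (fun ω' ↦ stepSup h ω' ^ 2 * {ω' | a / 2 < stepSup h ω'}.indicator (1 : WienerPair → ℝ) ω')
      wienerPair := by
    refine (hS2.mono' ((hmS.pow_const 2).mul ((measurable_indicator_const_iff 1).2
        (measurableSet_lt measurable_const hmS))).aestronglyMeasurable (ae_of_all _ fun ω' ↦ ?_))
    rw [Real.norm_eq_abs, abs_mul, abs_of_nonneg (sq_nonneg (stepSup h ω'))]
    have := abs_indicator_one_le {ω' | a / 2 < stepSup h ω'} ω'
    nlinarith [sq_nonneg (stepSup h ω'), abs_nonneg ({ω' | a / 2 < stepSup h ω'}.indicator (1 : WienerPair → ℝ) ω')]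
  have e1 : Integrable (fun ω' ↦ (4 * D.C₂ + 24 * D.C₁) * stepSup h ω' ^ 2 * nearSides z h ω') wienerPair := by
    have := i1.const_mul (4 * D.C₂ + 24 * D.C₁)
    refine this.congr (ae_of_all _ fun ω' ↦ ?_); simp only; ring
  have e2 : Integrable (fun ω' ↦ 25 * D.ω (5 * stepSup h ω') * stepSup h ω' ^ 2) wienerPair := by
    have := i2.const_mul 25
    refine this.congr (ae_of_all _ fun ω' ↦ ?_); simp only; ring
  have e3 : Integrable (fun ω' ↦ 2 * D.C_F * (goodEvent (a / 2) h)ᶜ.indicator (1 : WienerPair → ℝ) ω')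
      wienerPair := i3.const_mul _
  have e4 : Integrable (fun ω' ↦ 2 * D.C₁ * (2 / a + 1) *
      (stepSup h ω' ^ 2 * {ω' | a / 2 < stepSup h ω'}.indicator (1 : WienerPair → ℝ) ω')) wienerPair :=
    i4.const_mul _
  have e12 : Integrable (fun ω' ↦ (4 * D.C₂ + 24 * D.C₁) * stepSup h ω' ^ 2 * nearSides z h ω'
      + 25 * D.ω (5 * stepSup h ω') * stepSup h ω' ^ 2) wienerPair := e1.add e2
  have e123 : Integrable (fun ω' ↦ (4 * D.C₂ + 24 * D.C₁) * stepSup h ω' ^ 2 * nearSides z h ω'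
      + 25 * D.ω (5 * stepSup h ω') * stepSup h ω' ^ 2
      + 2 * D.C_F * (goodEvent (a / 2) h)ᶜ.indicator (1 : WienerPair → ℝ) ω') wienerPair := e12.add e3
  unfold stepDom
  rw [integral_add e123 e4, integral_add e12 e3, integral_add e1 e2, integral_const_mul, integral_const_mul,
    integral_indicator_one ((measurableSet_goodEvent _ h).compl)]
  have r1 : ∫ ω', (4 * D.C₂ + 24 * D.C₁) * stepSup h ω' ^ 2 * nearSides z h ω' ∂wienerPair =
      (4 * D.C₂ + 24 * D.C₁) * ∫ ω', stepSup h ω' ^ 2 * nearSides z h ω' ∂wienerPair := by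
    rw [← integral_const_mul]; congr 1; funext ω'; ring
  have r2 : ∫ ω', 25 * D.ω (5 * stepSup h ω') * stepSup h ω' ^ 2 ∂wienerPair =
      25 * ∫ ω', D.ω (5 * stepSup h ω') * stepSup h ω' ^ 2 ∂wienerPair := by
    rw [← integral_const_mul]; congr 1; funext ω'; ring
  rw [r1, r2]

end OrbmTestData

end Literature.Probability.RandomPlanarGeometry
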